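import Literature.MathematicalPhysics.QuantumLattice.SectorGroundProjContinuity
import Literature.MathematicalPhysics.QuantumLattice.FreeFermiGasPairGramBounds
import HarnessLib

/-!
# Crux `DressHalfFilled` (stmt-HubbardSuperconductivity-8148, routes `AnisotropyChord` / `LevyLogBootstrap`), stub 3
# `stub_dressHalfFilled`: two abstract lemmas for the fixed-`L` CONCENTRATION step (order inheritance)

Helper file (`--supports stmt-HubbardSuperconductivity-8148`). After `…SecondOrderTransverse` (a low-energy state `ψ` of
`H_in + t'T` has `‖ψ − Pψ‖² = O(t'²)`) and `…SecondOrderSelection` (its plaquette component `Pψ = Φφ` has XXZ energy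
`≤ e_XXZ‖φ‖² + O(t')`), two generic facts turn these into pair-field order:

* `defect_le_of_rayleigh_le` — APPROXIMATE MINIMISERS ARE CLOSE TO THE GROUND MULTIPLET: for Hermitian `A` and an `A`-invariant
  sector `K` there is `γ > 0` (the gap of `exists_gap_groundProj_form`) such that every `φ ∈ K` with
  `Re⟨φ, Aφ⟩ ≤ e‖φ‖² + δ` (`e = minEnergyOn A K`) has `‖φ‖² − Re⟨φ, P_E φ⟩ ≤ δ/γ`, `P_E` the orthogonal projection onto the
  ground multiplet `K ⊓ ker(A − e)`;
* `re_form_conjTranspose_mul_self_add_ge` — ORDER INHERITANCE for a positive form `O = Aᴴ A` (e.g. `Δ_d† Δ_d`):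
  `½·Re⟨χ, Oχ⟩ − Re⟨r, O r⟩ ≤ Re⟨χ + r, O(χ + r)⟩` — a state close to an ordered one keeps half its order minus the (small)
  order of the remainder.

HONEST LABEL: generic linear algebra; the assembly (XXZ ground multiplet at boson half filling has `Λ ≥ c(Δ_eff)M⁴` by
`HalfFilledOrder`, dictionary clause (e) and `DressZero.order_ge_of_pullback`, remainder `O_L(t')`) giving the anchor with
`t₀ = t₀(L)` is NOT done here; nothing uniform in `L`; no crux and no summit statement is proved. Sources: T. Kato (1966) II-§2.3
[Kato1966]; Tasaki (2020) §2.1. No definition and no named fact is introduced; sorry-free.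
-/

noncomputable section

-- `dupNamespace`: the summit and the problem are both named `HubbardSuperconductivity` (layout D-0022)
set_option linter.dupNamespace false

namespace Summit.HubbardSuperconductivity.HubbardSuperconductivity.Theorems.AnisotropyChord.DressSecond

open Matrix Literature.MathematicalPhysics.QuantumLattice
open scoped ComplexOrder

variable {ι : Type*} [Fintype ι] [DecidableEq ι]

/-- **Approximate minimisers are close to the ground multiplet.** For Hermitian `A` and an `A`-invariant subspace `K` there is
`γ > 0` such that every `φ ∈ K` with `Re⟨φ, Aφ⟩ ≤ e·‖φ‖² + δ`, `e = minEnergyOn A K`, satisfies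
`‖φ‖² − Re⟨φ, P_E φ⟩ ≤ δ/γ` (`P_E` = orthogonal projection onto the sector ground multiplet). Immediate from
`exists_gap_groundProj_form`. [folklore] -/
theorem defect_le_of_rayleigh_le {A : Matrix ι ι ℂ} (hA : A.IsHermitian) (K : Submodule ℂ (ι → ℂ))
    (hKA : ∀ v ∈ K, A *ᵥ v ∈ K) :
    ∃ γ : ℝ, 0 < γ ∧ ∀ φ ∈ K, ∀ δ : ℝ,
      (star φ ⬝ᵥ (A *ᵥ φ)).re ≤ A.minEnergyOn K * (star φ ⬝ᵥ φ).re + δ →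
      (star φ ⬝ᵥ φ).re - (star φ ⬝ᵥ (projMatrix ((K ⊓ Module.End.eigenspace
            (Matrix.toLin' A) ((A.minEnergyOn K : ℝ) : ℂ)).map
            ((WithLp.linearEquiv 2 ℂ (ι → ℂ)).symm : (ι → ℂ) →ₗ[ℂ] EuclideanSpace ℂ ι)) *ᵥ φ)).re ≤ δ / γ := by
  obtain ⟨γ, hγ, hgap⟩ := exists_gap_groundProj_form hA K hKA
  refine ⟨γ, hγ, fun φ hφ δ hδ => ?_⟩
  have h := hgap φ hφ
  rw [le_div_iff₀ hγ]
  linarith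

omit [DecidableEq ι] in
/-- **Order inheritance for a positive form.** For any matrix `A` and vectors `χ, r`:
`½·Re⟨χ, AᴴA χ⟩ − Re⟨r, AᴴA r⟩ ≤ Re⟨χ + r, AᴴA (χ + r)⟩` (`‖a + b‖² ≥ ½‖a‖² − ‖b‖²` for `a = Aχ`, `b = Ar`). [folklore] -/
theorem re_form_conjTranspose_mul_self_add_ge {κ : Type*} [Fintype κ] (A : Matrix κ ι ℂ) (χ r : ι → ℂ) :
    (1 / 2 : ℝ) * (star χ ⬝ᵥ ((Aᴴ * A) *ᵥ χ)).re - (star r ⬝ᵥ ((Aᴴ * A) *ᵥ r)).re ≤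
      (star (χ + r) ⬝ᵥ ((Aᴴ * A) *ᵥ (χ + r))).re := by
  -- `Re⟨v, AᴴA v⟩ = ‖A v‖²`
  have hform : ∀ v : ι → ℂ, star v ⬝ᵥ ((Aᴴ * A) *ᵥ v) = star (A *ᵥ v) ⬝ᵥ (A *ᵥ v) := by
    intro v
    rw [← mulVec_mulVec, star_mulVec, ← dotProduct_mulVec]
  rw [hform, hform, hform, mulVec_add]
  set a := A *ᵥ χ with ha
  set b := A *ᵥ r with hb
  set na : ℝ := (star a ⬝ᵥ a).re with hna
  set nb : ℝ := (star b ⬝ᵥ b).re with hnb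
  set x : ℝ := (star a ⬝ᵥ b).re with hx
  have hna0 : 0 ≤ na := (Complex.nonneg_iff.mp (dotProduct_star_self_nonneg a)).1
  have hnb0 : 0 ≤ nb := (Complex.nonneg_iff.mp (dotProduct_star_self_nonneg b)).1
  have hba : (star b ⬝ᵥ a).re = x := by
    rw [star_dotProduct, Complex.star_def, Complex.conj_re]
  have hsum : (star (a + b) ⬝ᵥ (a + b)).re = na + 2 * x + nb := by
    rw [star_add, add_dotProduct, dotProduct_add, dotProduct_add, Complex.add_re, Complex.add_re, Complex.add_re,
      ← hna, ← hnb, ← hx, hba]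
    ring
  -- Cauchy–Schwarz and AM–GM: `2|x| ≤ ½ na + 2 nb`
  have hcs : x ^ 2 ≤ na * nb := by
    have h := norm_star_dotProduct_sq_le a b
    rw [← hna, ← hnb] at h
    have h1 : x ^ 2 ≤ ‖star a ⬝ᵥ b‖ ^ 2 := by
      rw [hx, sq_le_sq, abs_norm]
      exact Complex.abs_re_le_norm _
    linarith
  rw [hsum]
  have hsq : (2 * x) ^ 2 ≤ (na / 2 + 2 * nb) ^ 2 := by nlinarith [sq_nonneg (na / 2 - 2 * nb), hcs]
  have h2 := (abs_le_of_sq_le_sq' hsq (by positivity)).1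
  linarith

end Summit.HubbardSuperconductivity.HubbardSuperconductivity.Theorems.AnisotropyChord.DressSecond

end
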